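import Summits.Langlands.Langlands.Theorems.SelfTwistRankSplit
import Summits.Langlands.Langlands.Theorems.RootDecomp1RestrictionTwistTransport
import Summits.Langlands.Langlands.Theorems.RootDecomp1DualTransport
import Summits.Langlands.Langlands.Theorems.TrivialHullDescent
import HarnessLib

/-!
# `RankMinimalPeeling` — E = `RootDecomp1.SemisimpleAvatar` ⟸ G ∧ Acc ∧ CPD♮ ∧ RPERF modulo PRINT, by
# RANK-MINIMALITY of a counterexample (decomp-langlands lens-4 «minimal counterexample», gen 39)

THESIS.  A counterexample `π` to E (stmt-Langlands-23598) of MINIMAL RANK `n` is never SELF-TWISTED: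
if `π` carries the a.e. `ζ_p`-Satake guard along a cyclic Galois layer `F/K` of prime degree `p`, then
`p ∣ n` (PROVED wall `SelfTwistRankSplit.finrank_dvd_of_selfTwistGuard`), `π = AI_{F/K}(Π₁)` with
`Π₁` cuspidal on `GL_{n/p}/F` (Arthur–Clozel Ch. 3 Thm. 4.2 (b): the named fact
`ArthurClozel1989_automorphicInduction_of_selfTwist`), `Π₁` is `L`-algebraic (Henniart 2012 +
Clozel 1990 §3.3: `isLAlgebraic_of_isAutomorphicInductionAlong`), `n/p < n` so `Π₁` has a semisimple
avatar by minimality, and the PROVED `inductionTransport_proof` (stmt-Langlands-29151) lifts it to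
`π`.  Hence SELF (27862), RSELF (28226) and the self-twisted sector of the atom CPD (27860) are NOT
NEEDED for E; the atom is weakened to CPD♮ = `NonSelfTwistedPrimeCyclicLayerDescent`.

KERNEL (0 sorry).  `selfTwisted_avatar_of_below` (the lever: PRINT³ → E below `n` → self-twisted
`π` of rank `n` have avatars) · `gradedAvatarDescent_of_pieces` (CPD♮ → RPERF → BCE → PRINT³ →
AvDesc-at-rank-`n`-given-E-below-`n`: the Galois-hull induction of `GaloisHullLift.closes` at FIXED
rank, self-twisted bottom layers discharged by the lever, trivial hull by `trivialHullDescent_proof`)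
· `semisimpleAvatar_of_graded` (G → Acc → graded descent → E: strong induction on the rank, the host
dial of `SemisimpleAvatar_of_split_proof` re-run on the rank-graded class, closures by Acc,
`restrictionTwistTransport_rootDecomp1`, graded descent + IH, `inductionTransport_proof` with
`IsAutomorphicInductionAlong.rank_eq`, `dualTransport_proof`) · `semisimpleAvatar_of_pieces`
(composition) · no-excess edges E → CPD♮, CPD → CPD♮, AvDesc → graded descent, base rung E below 2.
PRINT³ = AC Thm. 4.2 (b), Henniart Thm. 5, existence of infinity types (Clozel §3.3) — the three
named facts of `SelfTwistRankSplit.primeRankSelfTwistAvatar_of_print`, here at every rank `n/p`.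

References: Arthur–Clozel, Ann. of Math. Stud. 120 (1989), Ch. 3 Thm. 4.2, §6; Henniart, Bull. SMF
140 (2012) Thm. 5; Clozel, Perspect. Math. 10 (1990) §3.3; Buzzard–Gee, LMS LNS 414 (2014) 3.1.1.
-/

set_option linter.dupNamespace false

open scoped NumberField Classical
open Filter IsDedekindDomain
open Literature.NumberTheory.Automorphic
open Summit.Langlands.Langlands.Theses
open Summit.Langlands.Langlands.Theorems.SelfTwistRankSplit

namespace Summit.Langlands.Langlands.Theorems.RankMinimalPeeling

/-! ## §1 The one new piece and the two graded waypoints -/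

/-- **CPD♮ — non-self-twisted prime-cyclic layer descent.**  The atom CPD
(`CyclicLayerPeeling.PrimeCyclicLayerDescent`, stmt-Langlands-27860) VERBATIM with ONE inserted
hypothesis «`π` is NOT a.e.-Satake self-twisted along the cyclic prime layer `M/K`» (the negation of
the guard of SELF/BCE, written for the field `M`): weak base-change descent of semisimple `ℓ`-adic
avatars along ONE Galois cyclic layer `M/K` of prime degree along which `π ≇ π ⊗ η_{M/K}`.  This is
the only sector of CPD the peel induction ever calls (a layer is peeled only when `π` is not
self-twisted along it); the complementary self-twisted sector is closed in LOWER RANK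
(`selfTwisted_avatar_of_below`).  WEAKER than CPD (`nonSelfTwisted_of_primeCyclic`) and than E
(`nonSelfTwisted_of_semisimpleAvatar`). [ref: ArthurClozelAMS120, Ch. 3 Def. 1.1, Thm. 4.2 (a)]
[ref: Clifford 1937, Ann. of Math. 38] -/
def NonSelfTwistedPrimeCyclicLayerDescent : Prop :=
  ∀ (K : Type) [Field K] [NumberField K] (n : ℕ) (hcpt : Literature.NumberTheory.Automorphic.isCompact_glFiniteIntegralLevel n K), 0 < n → ∀ (π : Literature.NumberTheory.Automorphic.CuspidalAutomorphicRepData n K hcpt), π.1.IsLAlgebraic → ∀ (M : Type) [Field M] [NumberField M] [Algebra K M], IsGalois K M → IsCyclic (M ≃ₐ[K] M) → (Module.finrank K M).Prime → ¬ (∀ᶠ v : IsDedekindDomain.HeightOneSpectrum (NumberField.RingOfIntegers K) in cofinite, (∀ w : IsDedekindDomain.HeightOneSpectrum (NumberField.RingOfIntegers M), w.asIdeal.under (NumberField.RingOfIntegers K) = v.asIdeal → w.asIdeal.inertiaDeg (NumberField.RingOfIntegers K) ≠ 1) → ∀ α : Multiset ℂ, π.1.HasSatakeParamAt v α → α.map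 (fun z => Complex.exp (2 * Real.pi * Complex.I / (Module.finrank K M : ℂ)) * z) = α) → ∀ (hM : Literature.NumberTheory.Automorphic.isCompact_glFiniteIntegralLevel n M) (P : Literature.NumberTheory.Automorphic.CuspidalAutomorphicRepData n M hM), P.1.IsLAlgebraic → Literature.NumberTheory.Automorphic.IsWeakBaseChangeLiftAE π.1 P.1 → ∀ (ℓ : ℕ) [Fact ℓ.Prime] (ι : PadicAlgCl ℓ ≃+* ℂ) (r : Literature.NumberTheory.GaloisRepresentations.FramedGaloisRep M (PadicAlgCl ℓ) n), r.toGaloisRep.IsSemisimple → (∀ᶠ w : IsDedekindDomain.HeightOneSpectrum (NumberField.RingOfIntegers M) in cofinite, SatakeFrobCompatibleAt ι P.1 r w) → ∃ ρ : Literature.NumberTheory.GaloisRepresentations.FramedGaloisRep K (PadicAlgCl ℓ) n, ρ.toGaloisRep.IsSemisimple ∧ ∀ᶠ v : IsDedekindDomain.HeightOneSpectrum (NumberField.RingOfIntegers K) in cofinite, SatakeFrobCompatibleAt ι π.1 ρ v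

/-- **E below rank `N`**: `RootDecomp1.SemisimpleAvatar` (stmt-Langlands-23598) VERBATIM with the
guard `n < N →` inserted after the level binder — the rank-induction hypothesis. [ref: BuzzardGeeLMS2014, Conj. 3.2.1] -/
def SemisimpleAvatarBelow (N : ℕ) : Prop :=
  ∀ (K : Type) [Field K] [NumberField K] (n : ℕ) (hcpt : Literature.NumberTheory.Automorphic.isCompact_glFiniteIntegralLevel n K), n < N → 0 < n → ∀ (π : Literature.NumberTheory.Automorphic.CuspidalAutomorphicRepData n K hcpt), π.1.IsLAlgebraic → ∀ (ℓ : ℕ) [Fact ℓ.Prime] (ι : PadicAlgCl ℓ ≃+* ℂ), ∃ ρ : Literature.NumberTheory.GaloisRepresentations.FramedGaloisRep K (PadicAlgCl ℓ) n, ρ.toGaloisRep.IsSemisimple ∧ ∀ᶠ v : IsDedekindDomain.HeightOneSpectrum (NumberField.RingOfIntegers K) in cofinite, SatakeFrobCompatibleAt ι π.1 ρ v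

/-- **Graded avatar descent**: AvDesc (`RootDecomp1.AvatarDescent`, stmt-Langlands-29149) VERBATIM
with the hypothesis `SemisimpleAvatarBelow n →` inserted after the level binder — weak base-change
descent of semisimple avatars along an arbitrary finite layer `M/K` at rank `n`, GIVEN E in all ranks
`< n`.  WEAKER than AvDesc (`gradedAvatarDescent_of_avatarDescent`); proved from CPD♮ ∧ RPERF ∧ BCE
modulo PRINT (`gradedAvatarDescent_of_pieces`). [ref: ArthurClozelAMS120, Ch. 3 Thm. 4.2, Lemma 6.3] -/
def GradedAvatarDescent : Prop :=
  ∀ (K : Type) [Field K] [NumberField K] (n : ℕ) (hcpt : Literature.NumberTheory.Automorphic.isCompact_glFiniteIntegralLevel n K), SemisimpleAvatarBelow n → 0 < n → ∀ (π : Literature.NumberTheory.Automorphic.CuspidalAutomorphicRepData n K hcpt), π.1.IsLAlgebraic → ∀ (M : Type) [Field M] [NumberField M] [Algebra K M] (hM : Literature.NumberTheory.Automorphic.isCompact_glFiniteIntegralLevel n M) (P : Literature.NumberTheory.Automorphic.CuspidalAutomorphicRepData n M hM), P.1.IsLAlgebraic → Literature.NumberTheory.Automorphic.IsWeakBaseChangeLiftAE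 π.1 P.1 → ∀ (ℓ : ℕ) [Fact ℓ.Prime] (ι : PadicAlgCl ℓ ≃+* ℂ) (r : Literature.NumberTheory.GaloisRepresentations.FramedGaloisRep M (PadicAlgCl ℓ) n), r.toGaloisRep.IsSemisimple → (∀ᶠ w : IsDedekindDomain.HeightOneSpectrum (NumberField.RingOfIntegers M) in cofinite, SatakeFrobCompatibleAt ι P.1 r w) → ∃ ρ : Literature.NumberTheory.GaloisRepresentations.FramedGaloisRep K (PadicAlgCl ℓ) n, ρ.toGaloisRep.IsSemisimple ∧ ∀ᶠ v : IsDedekindDomain.HeightOneSpectrum (NumberField.RingOfIntegers K) in cofinite, SatakeFrobCompatibleAt ι π.1 ρ v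

/-! ## §2 No excess: the new decls are restrictions of existing items -/

/-- CPD → CPD♮ (drop the inserted hypothesis). [folklore] -/
theorem nonSelfTwisted_of_primeCyclic (h : CyclicLayerPeeling.PrimeCyclicLayerDescent) :
    NonSelfTwistedPrimeCyclicLayerDescent := by
  intro K _ _ n hcpt hn π hπ M _ _ _ hGal hcyc hp _ hM P hP hBC ℓ _ ι r hr hrc
  exact h K n hcpt hn π hπ M hGal hcyc hp hM P hP hBC ℓ ι r hr hrc

/-- E → CPD♮ (the conclusion of CPD♮ is E's for `π`). [folklore] -/
theorem nonSelfTwisted_of_semisimpleAvatar (hE : RootDecomp1.SemisimpleAvatar) :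
    NonSelfTwistedPrimeCyclicLayerDescent := by
  intro K _ _ n hcpt hn π hπ M _ _ _ _ _ _ _ hM P hP hBC ℓ _ ι r hr hrc
  exact hE K n hcpt hn π hπ ℓ ι

/-- AvDesc → GradedAvatarDescent (drop the rank-induction hypothesis). [folklore] -/
theorem gradedAvatarDescent_of_avatarDescent (h : RootDecomp1.AvatarDescent) :
    GradedAvatarDescent := by
  intro K _ _ n hcpt _ hn π hπ M _ _ _ hM P hP hBC ℓ _ ι r hr hrc
  exact h K n hcpt hn π hπ M hM P hP hBC ℓ ι r hr hrc

/-- E → `SemisimpleAvatarBelow N` for every `N`. [folklore] -/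
theorem semisimpleAvatarBelow_of_semisimpleAvatar (hE : RootDecomp1.SemisimpleAvatar) (N : ℕ) :
    SemisimpleAvatarBelow N := by
  intro K _ _ n hcpt _ hn π hπ ℓ _ ι
  exact hE K n hcpt hn π hπ ℓ ι

/-- **The base rung of the rank ladder is a theorem of the tree**: E below rank `2`, i.e. for
`n = 1` — Weil's `ℓ`-adic avatars of algebraic Hecke characters
(`SelfTwistRankSplit.exists_satakeFrobCompatible_rankOne`; rank-one framed representations are
semisimple).  So the strong rank induction of `semisimpleAvatar_of_graded` starts from a decided
rung, and the first rank at which the lever `selfTwisted_avatar_of_below` asks anything open of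
E-below is `n = 4` (`p = 2`, `Π₁` on `GL_2/F`). [cite: Weil1956, §1–§2]
[cite: BuzzardGeeLMS2014, Conj. 3.2.1 (n = 1)] -/
theorem semisimpleAvatarBelow_two : SemisimpleAvatarBelow 2 := by
  intro K _ _ n hcpt hn2 hn π hπ ℓ _ ι
  obtain rfl : n = 1 := by omega
  obtain ⟨r, hr⟩ := exists_satakeFrobCompatible_rankOne hcpt π hπ ι
  exact ⟨r, Literature.NumberTheory.GaloisRepresentations.FramedRep.isSemisimple_of_rank_one r, hr⟩

/-! ## §3 The lens-4 lever: a rank-minimal counterexample is not self-twisted -/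

/-- **A self-twisted `π` of rank `n` has a semisimple avatar as soon as E holds below rank `n`**
(modulo PRINT³).  `F/K` cyclic Galois of prime degree `p` carrying the a.e. `ζ_p`-Satake guard of
`π`: the PROVED wall gives `p ∣ n`; write `n = p·m`, `0 < m < n`; Arthur–Clozel Thm. 4.2 (b)
(`ArthurClozel1989_automorphicInduction_of_selfTwist`, its hypothesis supplied by
`acGuard_of_selfTwistGuard`) gives `Π₁` cuspidal on `GL_m/F` with `π = AI_{F/K}(Π₁)` a.e.;
`Π₁` is `L`-algebraic (`isLAlgebraic_of_isAutomorphicInductionAlong`: Henniart's archimedean relation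
+ existence of an infinity type); E below `n` gives a semisimple avatar `r` of `Π₁` over `F`; the
PROVED `inductionTransport_proof` turns it into one of `π` over `K`.
[cite: ArthurClozelAMS120, Ch. 3 Thm. 4.2 (b), Lemma 6.3, Thm. 6.2] [cite: Henniart2012, Thm. 5]
[cite: Clozel1990, §3.3] -/
theorem selfTwisted_avatar_of_below
    (hAC : ArthurClozel1989_automorphicInduction_of_selfTwist)
    (hH : Henniart2012_infinityType_of_automorphicInduction)
    (hInf : ∀ (N : ℕ) (E : Type) [Field E] [NumberField E] (hE : isCompact_glFiniteIntegralLevel N E)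
      (P : CuspidalAutomorphicRepData N E hE), P.1.exists_hasInfinityType)
    {K : Type} [Field K] [NumberField K] {n : ℕ} {hcpt : isCompact_glFiniteIntegralLevel n K}
    (hBelow : SemisimpleAvatarBelow n) (hn : 0 < n) (π : CuspidalAutomorphicRepData n K hcpt)
    (hπ : π.1.IsLAlgebraic) (F : Type) [Field F] [NumberField F] [Algebra K F] [IsGalois K F]
    (hcyc : IsCyclic (F ≃ₐ[K] F)) (hp : (Module.finrank K F).Prime)
    (hguard : ∀ᶠ v : HeightOneSpectrum (𝓞 K) in cofinite,
      (∀ w : HeightOneSpectrum (𝓞 F), w.asIdeal.under (𝓞 K) = v.asIdeal →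
          w.asIdeal.inertiaDeg (𝓞 K) ≠ 1) →
        ∀ α : Multiset ℂ, π.1.HasSatakeParamAt v α →
          α.map (fun z => Complex.exp (2 * Real.pi * Complex.I / (Module.finrank K F : ℂ)) * z) = α)
    (ℓ : ℕ) [Fact ℓ.Prime] (ι : PadicAlgCl ℓ ≃+* ℂ) :
    ∃ ρ : Literature.NumberTheory.GaloisRepresentations.FramedGaloisRep K (PadicAlgCl ℓ) n,
      ρ.toGaloisRep.IsSemisimple ∧
        ∀ᶠ v : HeightOneSpectrum (𝓞 K) in cofinite, SatakeFrobCompatibleAt ι π.1 ρ v := by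
  -- the wall: `p ∣ n`; write `n = p * m`
  obtain ⟨m, hnm⟩ := finrank_dvd_of_selfTwistGuard π F hcyc hp.one_lt hguard
  have hm : 0 < m := by
    rcases Nat.eq_zero_or_pos m with h | h
    · rw [h, mul_zero] at hnm; omega
    · exact h
  have hmn : m < n := by
    rw [hnm]; exact lt_mul_of_one_lt_left hm hp.one_lt
  have hFm := isCompact_glFiniteIntegralLevel_holds m F
  -- Arthur–Clozel Thm. 4.2 (b): `π = AI_{F/K}(Π₁)`, `Π₁ = Pf 1` cuspidal on `GL_m/F`
  obtain ⟨Pf, -, hAI⟩ :=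
    hAC K F n m hp hm (hnm.trans (mul_comm _ _)) hcpt hFm π (acGuard_of_selfTwistGuard hp π hguard)
  have hAI₁ : IsAutomorphicInductionAlong (Pf 1).1 π.1 := hAI 1
  -- `Π₁` is `L`-algebraic (Henniart + an infinity type)
  have hP₁L : (Pf 1).1.IsLAlgebraic :=
    isLAlgebraic_of_isAutomorphicInductionAlong hH hcyc hm hnm.symm π (Pf 1) hAI₁ hπ
      (hInf m F hFm (Pf 1))
  -- E below `n` at rank `m < n`, then the PROVED induction transport
  obtain ⟨r, hrss, hr⟩ := hBelow F m hFm hmn hm (Pf 1) hP₁L ℓ ι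
  exact inductionTransport_proof K F m n hFm hcpt hm hn (Pf 1) π hP₁L hπ hAI₁ ℓ ι r hrss hr

/-! ## §4 Graded avatar descent from CPD♮ ∧ RPERF ∧ BCE (the Galois-hull peel at fixed rank) -/

/-- **`GradedAvatarDescent` ⟸ CPD♮ ∧ RPERF ∧ BCE modulo PRINT³.**  The Galois-hull induction of
`GaloisHullLift.closes` (decomp-langlands lens-4 g24; `transport`, `hull`, normal-closure move copied
from that certified deciding theorem) at FIXED rank `n`, by strong induction on `d = [L:K]` for Galois
`L/K` and RELATIVE avatars `r : Γ_L → GL_n` of `π`: (peel) a cyclic-prime Galois bottom layer `F ≠ ⊥`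
along which `π` is not self-twisted — BCE gives `P₁` on `GL_n/F`, `transport` makes `r` relative to
`P₁` along `L/F`, the induction hypothesis (`[L:F] < d`) descends it to an avatar `r₁` of `P₁` over
`F`, and CPD♮ (its inserted hypothesis being exactly the peel condition) descends `r₁` to `K`;
(self-twisted) every cyclic-prime Galois bottom layer carries the guard and one exists —
`selfTwisted_avatar_of_below` (E below `n`); (trivial hull) `trivialHullDescent_proof` (PROVED,
stmt-Langlands-28227); (perfect hull) RPERF.  An arbitrary layer `M/K` with a cuspidal weak base change
`P` of `π` and an avatar `r` of `P` is moved to the Galois closure `L ⊇ M ⊇ K` by `restrictField`.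
[cite: ArthurClozelAMS120, Ch. 3 Thm. 4.2, Lemma 6.3] -/
theorem gradedAvatarDescent_of_pieces
    (hC : NonSelfTwistedPrimeCyclicLayerDescent) (hP : GaloisHullLift.PerfectHullDescent)
    (hB : CyclicLayerPeeling.CyclicBaseChangeBelow)
    (hAC : ArthurClozel1989_automorphicInduction_of_selfTwist)
    (hH : Henniart2012_infinityType_of_automorphicInduction)
    (hInf : ∀ (N : ℕ) (E : Type) [Field E] [NumberField E] (hE : isCompact_glFiniteIntegralLevel N E)
      (P : CuspidalAutomorphicRepData N E hE), P.1.exists_hasInfinityType) :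
    GradedAvatarDescent := by
  have transport : ∀ {n : ℕ} {K : Type} [Field K] [NumberField K] {F : Type} [Field F] [NumberField F] {L : Type} [Field L] [NumberField L] [Algebra K F] [Algebra F L] [Algebra K L] [IsScalarTower K F L] {hK : Literature.NumberTheory.Automorphic.isCompact_glFiniteIntegralLevel n K} {hF : Literature.NumberTheory.Automorphic.isCompact_glFiniteIntegralLevel n F} {ℓ : ℕ} [Fact ℓ.Prime] (π : Literature.NumberTheory.Automorphic.AutomorphicRepData (Literature.NumberTheory.Automorphic.AutomorphyDatum.gl n K hK)) (P₁ : Literature.NumberTheory.Automorphic.AutomorphicRepData (Literature.NumberTheory.Automorphic.AutomorphyDatum.gl n F hF)) (hBC : Literature.NumberTheory.Automorphic.IsWeakBaseChangeLiftAE π P₁) (ι : PadicAlgCl ℓ ≃+* ℂ) (r : Literature.NumberTheory.GaloisRepresentations.FramedGaloisRep L (PadicAlgCl ℓ) n), (∀ᶠ w : IsDedekindDomain.HeightOneSpectrum (NumberField.RingOfIntegers L) in cofinite, ∀ (v : IsDedekindDomain.HeightOneSpectrum (NumberField.RingOfIntegers K)) (α : Multiset ℂ), w.asIdeal.under (NumberField.RingOfIntegers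 K) = v.asIdeal → π.HasSatakeParamAt v α → r.IsUnramifiedAt w ∧ r.HasFrobCharpolyAt w (Literature.NumberTheory.Automorphic.arithFrobPolyOfSatake ι w.residueCard 1 (α.map (fun a => a ^ w.asIdeal.inertiaDeg (NumberField.RingOfIntegers K))))) → (∀ᶠ w : IsDedekindDomain.HeightOneSpectrum (NumberField.RingOfIntegers L) in cofinite, ∀ (u : IsDedekindDomain.HeightOneSpectrum (NumberField.RingOfIntegers F)) (β : Multiset ℂ), w.asIdeal.under (NumberField.RingOfIntegers F) = u.asIdeal → P₁.HasSatakeParamAt u β → r.IsUnramifiedAt w ∧ r.HasFrobCharpolyAt w (Literature.NumberTheory.Automorphic.arithFrobPolyOfSatake ι w.residueCard 1 (β.map (fun a => a ^ w.asIdeal.inertiaDeg (NumberField.RingOfIntegers F))))) := by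
    intro n K _ _ F _ _ L _ _ _ _ _ _ hK hF ℓ _ π P₁ hBC ι r h
    filter_upwards [h, Literature.NumberTheory.Automorphic.eventually_under (F := F) (E := L) hBC.eventually_hasSatakeParamAt_iff] with w hw hu u β hwu hβ
    obtain rfl : w.under (NumberField.RingOfIntegers F) = u := IsDedekindDomain.HeightOneSpectrum.ext hwu
    obtain ⟨α, hα, hiff⟩ := hu (w.under (NumberField.RingOfIntegers F)) rfl
    obtain rfl := (hiff β).1 hβ
    have hv : w.asIdeal.under (NumberField.RingOfIntegers K) = ((w.under (NumberField.RingOfIntegers F)).under (NumberField.RingOfIntegers K)).asIdeal := by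
      show w.asIdeal.under (NumberField.RingOfIntegers K) = (w.asIdeal.under (NumberField.RingOfIntegers F)).under (NumberField.RingOfIntegers K)
      rw [Ideal.under_under]
    obtain ⟨hur, hch⟩ := hw _ α hv hα
    refine ⟨hur, ?_⟩
    rw [Multiset.map_map]
    convert hch using 4
    simp only [Function.comp_apply]
    rw [← pow_mul]
    congr 1
    haveI : w.asIdeal.LiesOver (w.under (NumberField.RingOfIntegers F)).asIdeal := ⟨rfl⟩
    exact (Ideal.inertiaDeg_tower (w.under (NumberField.RingOfIntegers F)).asIdeal w.asIdeal).symm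
  have hull : ∀ (d : ℕ) (K : Type) [Field K] [NumberField K] (n : ℕ) (hcpt : Literature.NumberTheory.Automorphic.isCompact_glFiniteIntegralLevel n K), SemisimpleAvatarBelow n → 0 < n → ∀ (π : Literature.NumberTheory.Automorphic.CuspidalAutomorphicRepData n K hcpt), π.1.IsLAlgebraic → ∀ (L : Type) [Field L] [NumberField L] [Algebra K L], Module.finrank K L = d → IsGalois K L → ∀ (ℓ : ℕ) [Fact ℓ.Prime] (ι : PadicAlgCl ℓ ≃+* ℂ) (r : Literature.NumberTheory.GaloisRepresentations.FramedGaloisRep L (PadicAlgCl ℓ) n), r.toGaloisRep.IsSemisimple → (∀ᶠ w : IsDedekindDomain.HeightOneSpectrum (NumberField.RingOfIntegers L) in cofinite, ∀ (v : IsDedekindDomain.HeightOneSpectrum (NumberField.RingOfIntegers K)) (α : Multiset ℂ), w.asIdeal.under (NumberField.RingOfIntegers K) = v.asIdeal → π.1.HasSatakeParamAt v α → r.IsUnramifiedAt w ∧ r.HasFrobCharpolyAt w (Literature.NumberTheory.Automorphic.arithFrobPolyOfSatake ι w.residueCard 1 (α.map (fun a => a ^ w.asIdeal.inertiaDeg (NumberField.RingOfIntegers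 K))))) → ∃ ρ : Literature.NumberTheory.GaloisRepresentations.FramedGaloisRep K (PadicAlgCl ℓ) n, ρ.toGaloisRep.IsSemisimple ∧ ∀ᶠ v : IsDedekindDomain.HeightOneSpectrum (NumberField.RingOfIntegers K) in cofinite, SatakeFrobCompatibleAt ι π.1 ρ v := by
    intro d
    induction d using Nat.strong_induction_on with
    | _ d IH =>
    intro K _ _ n hcpt hE hn π hπ L _ _ _ hd hGal ℓ _ ι r hr hrel
    haveI : IsGalois K L := hGal
    by_cases hpeel : ∃ F : IntermediateField K L, (F ≠ ⊥ ∧ IsGalois K ↥F ∧ IsCyclic (↥F ≃ₐ[K] ↥F) ∧ (Module.finrank K ↥F).Prime) ∧ ¬ ((∀ᶠ v : IsDedekindDomain.HeightOneSpectrum (NumberField.RingOfIntegers K) in cofinite, (∀ w : IsDedekindDomain.HeightOneSpectrum (NumberField.RingOfIntegers ↥F), w.asIdeal.under (NumberField.RingOfIntegers K) = v.asIdeal → w.asIdeal.inertiaDeg (NumberField.RingOfIntegers K) ≠ 1) → ∀ α : Multiset ℂ, π.1.HasSatakeParamAt v α → α.map (fun z => Complex.exp (2 * Real.pi * Complex.I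 / (Module.finrank K ↥F : ℂ)) * z) = α))
    · -- PEEL a non-self-twisted cyclic-prime bottom layer: BCE up, IH at `[L:F] < d`, CPD♮ down
      obtain ⟨F, ⟨hbot, hGalF, hcycF, hpF⟩, hself⟩ := hpeel
      haveI : IsGalois K ↥F := hGalF
      obtain ⟨P₁, hP₁, hBC₁⟩ := hB K n hcpt hn π hπ (↥F) hGalF hcycF hpF hself (Literature.NumberTheory.Automorphic.isCompact_glFiniteIntegralLevel_holds n ↥F)
      have hrel₁ := transport (K := K) (F := ↥F) (L := L) π.1 P₁.1 hBC₁ ι r hrel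
      have hGal₁ : IsGalois (↥F) L := IsGalois.tower_top_of_isGalois K (↥F) L
      have hmul : Module.finrank K ↥F * Module.finrank ↥F L = Module.finrank K L := Module.finrank_mul_finrank K ↥F L
      have h1 : 1 < Module.finrank K ↥F := hpF.one_lt
      have hpos : 0 < Module.finrank ↥F L := Module.finrank_pos
      have hlt : Module.finrank ↥F L < d := by
        rw [← hd, ← hmul]; exact lt_mul_of_one_lt_left hpos h1
      obtain ⟨r₁, hr₁, hr₁c⟩ := IH _ hlt (↥F) n _ hE hn P₁ hP₁ L rfl hGal₁ ℓ ι r hr hrel₁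
      exact hC K n hcpt hn π hπ (↥F) hGalF hcycF hpF hself _ P₁ hP₁ hBC₁ ℓ ι r₁ hr₁ hr₁c
    by_cases hex : ∃ F : IntermediateField K L, (F ≠ ⊥ ∧ IsGalois K ↥F ∧ IsCyclic (↥F ≃ₐ[K] ↥F) ∧ (Module.finrank K ↥F).Prime)
    · -- SELF-TWISTED hull: a cyclic-prime Galois bottom layer exists and (¬hpeel) carries the guard;
      -- the lens-4 lever closes it from E below `n` — no descent of `r` at all
      obtain ⟨F, hbot, hGalF, hcycF, hpF⟩ := hex
      have hguard : (∀ᶠ v : IsDedekindDomain.HeightOneSpectrum (NumberField.RingOfIntegers K) in cofinite, (∀ w : IsDedekindDomain.HeightOneSpectrum (NumberField.RingOfIntegers ↥F), w.asIdeal.under (NumberField.RingOfIntegers K) = v.asIdeal → w.asIdeal.inertiaDeg (NumberField.RingOfIntegers K) ≠ 1) → ∀ α : Multiset ℂ, π.1.HasSatakeParamAt v α → α.map (fun z => Complex.exp (2 * Real.pi * Complex.I / (Module.finrank K ↥F : ℂ)) * z) = α) := by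
        by_contra hs
        exact hpeel ⟨F, ⟨hbot, hGalF, hcycF, hpF⟩, hs⟩
      haveI : IsGalois K ↥F := hGalF
      exact selfTwisted_avatar_of_below hAC hH hInf hE hn π hπ (↥F) hcycF hpF hguard ℓ ι
    by_cases h1 : Module.finrank K L = 1
    · exact trivialHullDescent_proof K n hcpt hn π hπ L hGal h1 ℓ ι r hr hrel
    · exact hP K n hcpt hn π hπ L hGal h1 hex ℓ ι r hr hrel
  -- an arbitrary layer `M/K`: pass to a Galois closure `L/K` of `M` and restrict `r` to `Γ_L`
  intro K _ _ n hcpt hE hn π hπ M _ _ _ hM P hP hBC ℓ _ ι r hr hrc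
  obtain ⟨L, _, _, _, _, _, hGal⟩ : ∃ (L : Type) (_ : Field L) (_ : NumberField L) (_ : Algebra K L) (_ : Algebra M L)
      (_ : IsScalarTower K M L), IsGalois K L := by
    let Ω := AlgebraicClosure M
    haveI : FiniteDimensional K M := Module.Finite.of_restrictScalars_finite ℚ K M
    haveI : Algebra.IsAlgebraic K Ω := Algebra.IsAlgebraic.trans K M Ω
    haveI : IsAlgClosure K Ω := ⟨inferInstance, inferInstance⟩
    haveI : Normal K Ω := IsAlgClosure.normal K Ω
    let N' : IntermediateField K Ω := IntermediateField.normalClosure K M Ω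
    haveI : FiniteDimensional K N' := normalClosure.is_finiteDimensional K M Ω
    haveI : Normal K N' := normalClosure.normal K M Ω
    haveI : Algebra.IsSeparable K N' := Algebra.IsAlgebraic.isSeparable_of_perfectField
    haveI hG : IsGalois K N' := IsGalois.mk
    haveI : NumberField N' := NumberField.of_module_finite K N'
    exact ⟨N', inferInstance, inferInstance, inferInstance, inferInstance, inferInstance, hG⟩
  haveI : IsGalois K L := hGal
  haveI : IsGalois M L := IsGalois.tower_top_of_isGalois K M L
  have hrel : (∀ᶠ w' : IsDedekindDomain.HeightOneSpectrum (NumberField.RingOfIntegers L) in cofinite, ∀ (v : IsDedekindDomain.HeightOneSpectrum (NumberField.RingOfIntegers K)) (α : Multiset ℂ), w'.asIdeal.under (NumberField.RingOfIntegers K) = v.asIdeal → π.1.HasSatakeParamAt v α → (r.restrictField L).IsUnramifiedAt w' ∧ (r.restrictField L).HasFrobCharpolyAt w' (Literature.NumberTheory.Automorphic.arithFrobPolyOfSatake ι w'.residueCard 1 (α.map (fun a => a ^ w'.asIdeal.inertiaDeg (NumberField.RingOfIntegers K))))) := by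
    filter_upwards [Literature.NumberTheory.Automorphic.eventually_under (F := M) (E := L) hBC, Literature.NumberTheory.Automorphic.eventually_under (F := M) (E := L) hrc] with w' hBCw hrcw v α hv hα
    have hwv : (w'.under (NumberField.RingOfIntegers M)).asIdeal.under (NumberField.RingOfIntegers K) = v.asIdeal := by
      show (w'.asIdeal.under (NumberField.RingOfIntegers M)).under (NumberField.RingOfIntegers K) = v.asIdeal
      rw [Ideal.under_under]; exact hv
    have hPw : P.1.HasSatakeParamAt (w'.under (NumberField.RingOfIntegers M)) (α.map (· ^ (w'.under (NumberField.RingOfIntegers M)).asIdeal.inertiaDeg (NumberField.RingOfIntegers K))) :=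
      hBCw _ rfl v α hwv hα
    obtain ⟨β, hβ, hur, hch⟩ := hrcw (w'.under (NumberField.RingOfIntegers M)) rfl
    obtain rfl := P.1.hasSatakeParamAt_unique_holds hβ hPw
    have key := Literature.NumberTheory.Automorphic.hasFrobCharpolyAt_restrictField_arithFrobPolyOfSatake (L := L) ι r (v := w'.under (NumberField.RingOfIntegers M)) (w := w') rfl hur 1 hch
    rw [Multiset.map_map] at key
    refine ⟨key.1, ?_⟩
    convert key.2 using 4
    simp only [Function.comp_apply]
    rw [← pow_mul]
    congr 1
    haveI : w'.asIdeal.LiesOver (w'.under (NumberField.RingOfIntegers M)).asIdeal := ⟨rfl⟩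
    exact Ideal.inertiaDeg_tower (w'.under (NumberField.RingOfIntegers M)).asIdeal w'.asIdeal
  exact hull _ K n hcpt hE hn π hπ L rfl hGal ℓ ι (r.restrictField L) (r.isSemisimple_restrictField hr) hrel

/-! ## §5 E from G ∧ Acc ∧ GradedAvatarDescent: the host dial re-run by strong induction on the rank -/

/-- **E ⟸ G ∧ Acc ∧ `GradedAvatarDescent`** (RTT, AIT, DT being THEOREMS of the tree:
`restrictionTwistTransport_rootDecomp1`, `inductionTransport_proof`, `dualTransport_proof`).  Strong
induction on the rank `N`.  At ranks `≤ N`: excluded middle on the host dial «`π` special» of G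
(`RootDecomp1.DarkPrimitiveAvatars`, stmt-Langlands-29147).  Special: apply the dial's minimality to the
RANK-GRADED class `T_N K n π := n ≤ N → (π cuspidal, L-algebraic ⇒ semisimple avatars at every ℓ, ι)`,
whose five closure properties are Acc (accessible base fields), RTT (up-transport, same rank), graded
descent (same rank; its E-below-`n` hypothesis is the induction hypothesis since `n ≤ N`), AIT (the
rank can only DROP along automorphic induction: `n = m·[L:K]`, `IsAutomorphicInductionAlong.rank_eq`,
so the graded hypothesis on `σ` is available) and DT (same rank).  Non-special: G verbatim.
Compare the host glue `SemisimpleAvatar_of_split_proof` (ungraded class, AvDesc whole).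
[cite: ArthurClozelAMS120, Ch. 3 §6] [cite: BuzzardGeeLMS2014, Conj. 3.2.1] -/
theorem semisimpleAvatar_of_graded (hG : RootDecomp1.DarkPrimitiveAvatars)
    (hAcc : RootDecomp1.AccessibleAvatars) (hD : GradedAvatarDescent) :
    RootDecomp1.SemisimpleAvatar := by
  suffices key : ∀ (N : ℕ) (K : Type) [Field K] [NumberField K] (n : ℕ) (hcpt : Literature.NumberTheory.Automorphic.isCompact_glFiniteIntegralLevel n K), n ≤ N → 0 < n → ∀ (π : Literature.NumberTheory.Automorphic.CuspidalAutomorphicRepData n K hcpt), π.1.IsLAlgebraic → ∀ (ℓ : ℕ) [Fact ℓ.Prime] (ι : PadicAlgCl ℓ ≃+* ℂ), ∃ ρ : Literature.NumberTheory.GaloisRepresentations.FramedGaloisRep K (PadicAlgCl ℓ) n, ρ.toGaloisRep.IsSemisimple ∧ ∀ᶠ v : IsDedekindDomain.HeightOneSpectrum (NumberField.RingOfIntegers K) in cofinite, SatakeFrobCompatibleAt ι π.1 ρ v by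
    intro K _ _ n hcpt hn π hπ ℓ _ ι
    exact key n K n hcpt le_rfl hn π hπ ℓ ι
  intro N
  induction N using Nat.strong_induction_on with
  | _ N IHN =>
  -- the rank-induction hypothesis: E below every `n ≤ N`
  have hBelow : ∀ {n : ℕ}, n ≤ N → SemisimpleAvatarBelow n := by
    intro n hnN K _ _ m hcpt hmn hm π hπ ℓ _ ι
    exact IHN m (lt_of_lt_of_le hmn hnN) K m hcpt le_rfl hm π hπ ℓ ι
  intro K _ _ n hcpt hnN hn π hπ ℓ _ ι
  by_cases hsp : (∀ S : (∀ (K : Type) [Field K] [NumberField K] (n : ℕ) (hcpt : Literature.NumberTheory.Automorphic.isCompact_glFiniteIntegralLevel n K), Literature.NumberTheory.Automorphic.AutomorphicRepData (Literature.NumberTheory.Automorphic.AutomorphyDatum.gl n K hcpt) → Prop), ((∀ (K : Type) [Field K] [NumberField K] (n : ℕ) (hcpt : Literature.NumberTheory.Automorphic.isCompact_glFiniteIntegralLevel n K) (π : Literature.NumberTheory.Automorphic.AutomorphicRepData (Literature.NumberTheory.Automorphic.AutomorphyDatum.gl n K hcpt)), Module.finrank (NumberField.maximalRealSubfield K) K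 ≤ 2 → S K n hcpt π) ∧ (∀ (K₀ : Type) [Field K₀] [NumberField K₀] (M : Type) [Field M] [NumberField M] [Algebra K₀ M] (n : ℕ) (h₀ : Literature.NumberTheory.Automorphic.isCompact_glFiniteIntegralLevel n K₀) (hM : Literature.NumberTheory.Automorphic.isCompact_glFiniteIntegralLevel n M) (h₁ : Literature.NumberTheory.Automorphic.isCompact_glFiniteIntegralLevel 1 M) (π₀ : Literature.NumberTheory.Automorphic.CuspidalAutomorphicRepData n K₀ h₀) (χ : Literature.NumberTheory.Automorphic.AutomorphicRepData (Literature.NumberTheory.Automorphic.AutomorphyDatum.gl 1 M h₁)) (P : Literature.NumberTheory.Automorphic.AutomorphicRepData (Literature.NumberTheory.Automorphic.AutomorphyDatum.gl n M hM)), π₀.1.IsLAlgebraic → χ.IsLAlgebraic → (∀ᶠ w : IsDedekindDomain.HeightOneSpectrum (NumberField.RingOfIntegers M) in cofinite, ∀ (u : IsDedekindDomain.HeightOneSpectrum (NumberField.RingOfIntegers K₀)) (α : Multiset ℂ) (c : ℂ), w.asIdeal.under (NumberField.RingOfIntegers K₀) = u.asIdeal → π₀.1.HasSatakeParamAt u α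 → χ.HasSatakeParamAt w {c} → P.HasSatakeParamAt w ((α.map (· ^ w.asIdeal.inertiaDeg (NumberField.RingOfIntegers K₀))).map (c * ·))) → S K₀ n h₀ π₀.1 → S M n hM P) ∧ (∀ (K : Type) [Field K] [NumberField K] (M : Type) [Field M] [NumberField M] [Algebra K M] (n : ℕ) (hcpt : Literature.NumberTheory.Automorphic.isCompact_glFiniteIntegralLevel n K) (hM : Literature.NumberTheory.Automorphic.isCompact_glFiniteIntegralLevel n M) (π : Literature.NumberTheory.Automorphic.AutomorphicRepData (Literature.NumberTheory.Automorphic.AutomorphyDatum.gl n K hcpt)) (P : Literature.NumberTheory.Automorphic.CuspidalAutomorphicRepData n M hM), P.1.IsLAlgebraic → Literature.NumberTheory.Automorphic.IsWeakBaseChangeLiftAE π P.1 → S M n hM P.1 → S K n hcpt π) ∧ (∀ (K : Type) [Field K] [NumberField K] (L : Type) [Field L] [NumberField L] [Algebra K L] (m n : ℕ) (hL : Literature.NumberTheory.Automorphic.isCompact_glFiniteIntegralLevel m L) (hcpt : Literature.NumberTheory.Automorphic.isCompact_glFiniteIntegralLevel n K) (σ : Literature.NumberTheory.Automorphic.CuspidalAutomorphicRepData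 m L hL) (π : Literature.NumberTheory.Automorphic.AutomorphicRepData (Literature.NumberTheory.Automorphic.AutomorphyDatum.gl n K hcpt)), 0 < m → σ.1.IsLAlgebraic → (∀ᶠ v : IsDedekindDomain.HeightOneSpectrum (NumberField.RingOfIntegers K) in cofinite, ∀ β : IsDedekindDomain.HeightOneSpectrum (NumberField.RingOfIntegers L) → Multiset ℂ, (∀ w : IsDedekindDomain.HeightOneSpectrum (NumberField.RingOfIntegers L), w.asIdeal.under (NumberField.RingOfIntegers K) = v.asIdeal → σ.1.HasSatakeParamAt w (β w)) → ∃ α : Multiset ℂ, π.HasSatakeParamAt v α ∧ Literature.NumberTheory.Automorphic.satakePolynomial α = ∏ᶠ w ∈ {w : IsDedekindDomain.HeightOneSpectrum (NumberField.RingOfIntegers L) | w.asIdeal.under (NumberField.RingOfIntegers K) = v.asIdeal}, (Literature.NumberTheory.Automorphic.satakePolynomial (β w)).comp (Polynomial.X ^ w.asIdeal.inertiaDeg (NumberField.RingOfIntegers K))) → S L m hL σ.1 → S K n hcpt π) ∧ (∀ (K : Type) [Field K] [NumberField K] (n : ℕ) (hcpt : Literature.NumberTheory.Automorphic.isCompact_glFiniteIntegralLevel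 n K) (π : Literature.NumberTheory.Automorphic.CuspidalAutomorphicRepData n K hcpt) (P : Literature.NumberTheory.Automorphic.AutomorphicRepData (Literature.NumberTheory.Automorphic.AutomorphyDatum.gl n K hcpt)), π.1.IsLAlgebraic → (∀ᶠ v : IsDedekindDomain.HeightOneSpectrum (NumberField.RingOfIntegers K) in cofinite, ∀ α : Multiset ℂ, π.1.HasSatakeParamAt v α → P.HasSatakeParamAt v (α.map (·⁻¹))) → S K n hcpt π.1 → S K n hcpt P)) → S K n hcpt π.1)
  · refine hsp
      (fun K _ _ n hcpt π => n ≤ N → 0 < n → π.W ≤ Literature.NumberTheory.Automorphic.cuspFormsGL n K hcpt → π.IsLAlgebraic → ∀ (ℓ : ℕ) [Fact ℓ.Prime] (ι : PadicAlgCl ℓ ≃+* ℂ), ∃ ρ : Literature.NumberTheory.GaloisRepresentations.FramedGaloisRep K (PadicAlgCl ℓ) n, ρ.toGaloisRep.IsSemisimple ∧ ∀ᶠ v : IsDedekindDomain.HeightOneSpectrum (NumberField.RingOfIntegers K) in cofinite, SatakeFrobCompatibleAt ι π ρ v)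
      ⟨?_, ?_, ?_, ?_, ?_⟩ hnN hn π.2 hπ ℓ ι
    · -- accessible base fields: Acc
      intro K _ _ n hcpt π hK _ hn hc hL ℓ _ ι
      exact hAcc K n hcpt hn hK ⟨π, hc⟩ hL ℓ ι
    · -- twisted restriction along a finite layer (same rank): RTT, PROVED
      intro K₀ _ _ M _ _ _ n h₀ hM h₁ π₀ χ P hπ₀L hχL htw ih hnN hn hPc hPL ℓ _ ι
      obtain ⟨ρ₀, hρ₀ss, hρ₀⟩ := ih hnN hn π₀.2 hπ₀L ℓ ι
      exact restrictionTwistTransport_rootDecomp1 K₀ M n h₀ hM h₁ hn π₀ χ ⟨P, hPc⟩ hπ₀L hχL hPL htw ℓ ι ρ₀ hρ₀ss hρ₀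
    · -- weak base-change descent (same rank): graded descent, E below `n ≤ N` from the induction
      intro K _ _ M _ _ _ n hcpt hM π P hPL hBC ih hnN hn hc hπL ℓ _ ι
      obtain ⟨r, hrss, hr⟩ := ih hnN hn P.2 hPL ℓ ι
      exact hD K n hcpt (hBelow hnN) hn ⟨π, hc⟩ hπL M hM P hPL hBC ℓ ι r hrss hr
    · -- automorphic induction (the rank drops: `n = m·[L:K]`): AIT, PROVED
      intro K _ _ L _ _ _ m n hL hcpt σ π hm hσL hAI ih hnN hn hc hπL ℓ _ ι
      have hAI' : IsAutomorphicInductionAlong σ.1 π := hAI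
      have hmn : m ≤ n := Nat.le_of_dvd hn ⟨Module.finrank K L, hAI'.rank_eq⟩
      obtain ⟨r, hrss, hr⟩ := ih (hmn.trans hnN) hm σ.2 hσL ℓ ι
      exact inductionTransport_proof K L m n hL hcpt hm hn σ ⟨π, hc⟩ hσL hπL hAI ℓ ι r hrss hr
    · -- duals (same rank): DT, PROVED
      intro K _ _ n hcpt π P hπL hdual ih hnN hn hc hPL ℓ _ ι
      obtain ⟨ρ, hρss, hρ⟩ := ih hnN hn π.2 hπL ℓ ι
      exact dualTransport_proof K n hcpt hn π ⟨P, hc⟩ hπL hPL hdual ℓ ι ρ hρss hρ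
  · exact hG K n hcpt hn π hπ hsp ℓ ι

/-! ## §6 The node: E ⟸ G ∧ Acc ∧ CPD♮ ∧ RPERF ∧ BCE modulo PRINT³ -/

/-- **E = `RootDecomp1.SemisimpleAvatar` ⟸ G ∧ Acc ∧ CPD♮ ∧ RPERF ∧ BCE, modulo PRINT³** — the
lens-4 g39 node: composition of `semisimpleAvatar_of_graded` with `gradedAvatarDescent_of_pieces`.
Open binders: G (`DarkPrimitiveAvatars`, 29147, residual), Acc (`AccessibleAvatars`, 29148), CPD♮
(`NonSelfTwistedPrimeCyclicLayerDescent`, NEW, weaker than CPD 27860), RPERF (`PerfectHullDescent`,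
28225, residual); print binders: BCE (`CyclicBaseChangeBelow`, 27863; Arthur–Clozel Thm. 4.2 (a)),
`ArthurClozel1989_automorphicInduction_of_selfTwist` (Thm. 4.2 (b)),
`Henniart2012_infinityType_of_automorphicInduction` (Henniart Thm. 5), existence of infinity types
(Clozel 1990 §3.3).  SELF 27862, RSELF 28226, AvDesc 29149, ANAB 27861, CPD 27860 are all restrictions
of E, hence consequences of the same binders. [cite: ArthurClozelAMS120, Ch. 3 Thm. 4.2, §6]
[cite: Henniart2012, Thm. 5] [cite: Clozel1990, §3.3] -/
theorem semisimpleAvatar_of_pieces (hG : RootDecomp1.DarkPrimitiveAvatars)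
    (hAcc : RootDecomp1.AccessibleAvatars) (hC : NonSelfTwistedPrimeCyclicLayerDescent)
    (hP : GaloisHullLift.PerfectHullDescent) (hB : CyclicLayerPeeling.CyclicBaseChangeBelow)
    (hAC : ArthurClozel1989_automorphicInduction_of_selfTwist)
    (hH : Henniart2012_infinityType_of_automorphicInduction)
    (hInf : ∀ (N : ℕ) (E : Type) [Field E] [NumberField E] (hE : isCompact_glFiniteIntegralLevel N E)
      (P : CuspidalAutomorphicRepData N E hE), P.1.exists_hasInfinityType) :
    RootDecomp1.SemisimpleAvatar :=
  semisimpleAvatar_of_graded hG hAcc (gradedAvatarDescent_of_pieces hC hP hB hAC hH hInf)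

/-- Corollary: the whole peel subtree follows from the same binders — AvDesc (29149). [folklore] -/
theorem avatarDescent_of_pieces (hG : RootDecomp1.DarkPrimitiveAvatars)
    (hAcc : RootDecomp1.AccessibleAvatars) (hC : NonSelfTwistedPrimeCyclicLayerDescent)
    (hP : GaloisHullLift.PerfectHullDescent) (hB : CyclicLayerPeeling.CyclicBaseChangeBelow)
    (hAC : ArthurClozel1989_automorphicInduction_of_selfTwist)
    (hH : Henniart2012_infinityType_of_automorphicInduction)
    (hInf : ∀ (N : ℕ) (E : Type) [Field E] [NumberField E] (hE : isCompact_glFiniteIntegralLevel N E)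
      (P : CuspidalAutomorphicRepData N E hE), P.1.exists_hasInfinityType) :
    RootDecomp1.AvatarDescent := by
  have hE := semisimpleAvatar_of_pieces hG hAcc hC hP hB hAC hH hInf
  intro K _ _ n hcpt hn π hπ M _ _ _ hM P hP hBC ℓ _ ι r hr hrc
  exact hE K n hcpt hn π hπ ℓ ι

/-- Corollary: SELF (stmt-Langlands-27862) from the same binders. [folklore] -/
theorem selfTwistedLayerDescent_of_pieces (hG : RootDecomp1.DarkPrimitiveAvatars)
    (hAcc : RootDecomp1.AccessibleAvatars) (hC : NonSelfTwistedPrimeCyclicLayerDescent)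
    (hP : GaloisHullLift.PerfectHullDescent) (hB : CyclicLayerPeeling.CyclicBaseChangeBelow)
    (hAC : ArthurClozel1989_automorphicInduction_of_selfTwist)
    (hH : Henniart2012_infinityType_of_automorphicInduction)
    (hInf : ∀ (N : ℕ) (E : Type) [Field E] [NumberField E] (hE : isCompact_glFiniteIntegralLevel N E)
      (P : CuspidalAutomorphicRepData N E hE), P.1.exists_hasInfinityType) :
    CyclicLayerPeeling.SelfTwistedLayerDescent := by
  have hE := semisimpleAvatar_of_pieces hG hAcc hC hP hB hAC hH hInf
  intro K _ _ n hcpt hn π hπ M _ _ _ _ hM P hP hBC ℓ _ ι r hr hrc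
  exact hE K n hcpt hn π hπ ℓ ι

/-- Corollary: RSELF (stmt-Langlands-28226) from the same binders. [folklore] -/
theorem selfTwistedHullDescent_of_pieces (hG : RootDecomp1.DarkPrimitiveAvatars)
    (hAcc : RootDecomp1.AccessibleAvatars) (hC : NonSelfTwistedPrimeCyclicLayerDescent)
    (hP : GaloisHullLift.PerfectHullDescent) (hB : CyclicLayerPeeling.CyclicBaseChangeBelow)
    (hAC : ArthurClozel1989_automorphicInduction_of_selfTwist)
    (hH : Henniart2012_infinityType_of_automorphicInduction)
    (hInf : ∀ (N : ℕ) (E : Type) [Field E] [NumberField E] (hE : isCompact_glFiniteIntegralLevel N E)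
      (P : CuspidalAutomorphicRepData N E hE), P.1.exists_hasInfinityType) :
    GaloisHullLift.SelfTwistedHullDescent := by
  have hE := semisimpleAvatar_of_pieces hG hAcc hC hP hB hAC hH hInf
  intro K _ _ n hcpt hn _ π hπ L _ _ _ _ _ _ ℓ _ ι r hr hrel
  exact hE K n hcpt hn π hπ ℓ ι

end Summit.Langlands.Langlands.Theorems.RankMinimalPeeling
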